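import Mathlib
import Summits.NavierStokesRegularity.NavierStokesRegularity.Theorems.TaoLadderRungTwoBreakOneShiftT4W76RDefs
import Summits.NavierStokesRegularity.NavierStokesRegularity.Theorems.TaoLadderRungTwoBreakOneShiftT4W76Rows
import HarnessLib

/-!
# The one-shift instance T4 @ ε₀ = 1/10, W = 76, REPLAY-SIZED VARIANT (R): the frame / scalar / ROW arithmetic of
# `exists_surviving_dssWave_of_windowCert_v7s` in the kernel (exact rationals) — helper module of `…OneShiftT4W76R`
# (cell harvest/h2-tao-ladder, seat p2; rung1/RUNG1-P2G16-REPORT.md §79; support for K1(1) = `NoSurvivingDSSOne`,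
# stmt-NavierStokesRegularity-20205)

MODEL lattice only (Tao-type averaged cascade with the comparable circuit table T4, scale ratio `11/10`);
nothing here is a statement about the Navier–Stokes equations; no item is closed.

As `…OneShiftT4W76Rows` (whose `Λ₀`-bounds and table lemmas are reused), for the variant frame of `…T4W76RDefs`
(wide hull `[1.03393, 1.03395]`, `r₀ = 8.16·10⁻⁵`, top ratio `1/16`) and the generous certificate-side constants
`Z = 1/50`, `S_b = 1/20`, `S_e = 10²⁸`, `γ = (10⁻⁶, 10⁻⁶, 10²²)`, shell-0 `(10⁻³, 10⁻³, 10²⁰)`, `A₁ = 10⁻⁵`: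
the values of the closed-form frame functions on the wake / top shells and at the two edge shells, and the nine
finite rows of `…_v7s` with `q = 13/25`.  Python exact-rational twin with the same constants:
harvest/h2-tao-ladder rung1/num4c/inst_T4W76R_exact.py (76 checks, all OK).
-/

noncomputable section

-- the sub-problem namespace repeats the summit name by design (D-0017)
set_option linter.dupNamespace false

namespace Summit.NavierStokesRegularity.NavierStokesRegularity.Theorems

namespace DSSOneShift

open Set Literature.Analysis.FluidPDE Literature.Analysis.FluidPDE.TaoCascade CertificateGlueOn
open OneShiftFrame (quadTermLip tableAbsSum quadTermLip_le_of_bounds)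

namespace T4W76R

open T4W76 (ghat κw cmax Q S εR ωt abart τc rτ αT4 BoxData tubeCT4 bigLam_tenth_bounds bigLam_tenth_pow_76
  tableAbsSum_αT4_le tableAbsSum_nonneg toNat_two tubeCT4_wake tubeCT4_top τhi_nonneg)

/-! ### Values of the frame functions -/

/-- [folklore] -/
theorem AT4_nonneg (k : ℤ) : 0 ≤ T4W76R.AT4 k := by
  unfold AT4 βw gHi ϑt T4W76.Q T4W76.εR T4W76.abart; split_ifs <;> positivity

/-- [folklore] -/
theorem RT4_nonneg (k : ℤ) : 0 ≤ T4W76R.RT4 k := by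
  have hpos : 0 < bigLam (1 / 10 : ℝ) := bigLam_pos (by norm_num)
  unfold RT4 βw gHi ϑt T4W76.S T4W76.Q T4W76.abart; split_ifs <;> positivity

/-- [folklore] -/
theorem vmaxT4_nonneg (k : ℤ) : 0 ≤ T4W76R.vmaxT4 k := by unfold vmaxT4; split_ifs <;> positivity
/-- [folklore] -/
theorem χbT4_nonneg (k : ℤ) : 0 ≤ T4W76R.χbT4 k := by unfold χbT4; split_ifs <;> positivity
/-- [folklore] -/
theorem χeT4_nonneg (k : ℤ) : 0 ≤ T4W76R.χeT4 k := by unfold χeT4; split_ifs <;> positivity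

/-- [folklore] -/
theorem wtT4_wake (n : ℕ) : T4W76R.wtT4 (-(n : ℤ) - 1) = 1 * T4W76R.θw ^ (n + 1) := by
  have e : (-(-(n : ℤ) - 1)).toNat = n + 1 := by omega
  unfold wtT4; rw [if_pos (by omega), e, one_mul]

/-- [folklore] -/
theorem wtT4_top (j : ℕ) : T4W76R.wtT4 ((76 : ℤ) + (j : ℤ)) = ωt * ϑt ^ j := by
  have e : ((76 : ℤ) + (j : ℤ) - 76).toNat = j := by omega
  unfold wtT4; rw [if_neg (by omega), if_pos (by omega), e]

/-- [folklore] -/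
theorem tubeRT4_wake (n : ℕ) : T4W76R.tubeRT4 (-(n : ℤ) - 1) = T4W76R.gHi ^ (n + 1) * (T4W76R.r₀ + κw * ((n : ℝ) + 1)) := by
  have e : (-(-(n : ℤ) - 1)).toNat = n + 1 := by omega
  unfold tubeRT4; rw [if_pos (by omega), e]; push_cast; ring

/-- [folklore] -/
theorem tubeRT4_top (j : ℕ) : T4W76R.tubeRT4 ((76 : ℤ) + (j : ℤ)) = εR * ϑt ^ j := by
  have e : ((76 : ℤ) + (j : ℤ) - 76).toNat = j := by omega
  unfold tubeRT4; rw [if_neg (by omega), if_pos (by omega), e]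

/-- [folklore] -/
theorem AT4_wake (n : ℕ) : T4W76R.AT4 (-(n : ℤ) - 1) = Q * T4W76R.βw ^ (n + 1) := by
  have e : (-(-(n : ℤ) - 1)).toNat = n + 1 := by omega
  unfold AT4; rw [if_pos (by omega), e]

/-- [folklore] -/
theorem AT4_top (j : ℕ) : T4W76R.AT4 ((76 : ℤ) + (j : ℤ)) = εR * ϑt ^ j := by
  have e : ((76 : ℤ) + (j : ℤ) - 76).toNat = j := by omega
  unfold AT4; rw [if_neg (by omega), if_pos (by omega), e]

/-- [folklore] -/
theorem RT4_wake (j : ℕ) :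
    T4W76R.RT4 (-(j : ℤ) - 1) = (S * Q ^ 2 * T4W76R.βw ^ 2) * (T4W76R.βw ^ 2 * (bigLam (1 / 10))⁻¹) ^ (j + 1) := by
  have e : (-(-(j : ℤ) - 1)).toNat = j + 1 := by omega
  unfold RT4; rw [if_pos (by omega), e]

/-- [folklore] -/
theorem RT4_top (j : ℕ) : T4W76R.RT4 ((76 : ℤ) + (j : ℤ)) =
    (S * abart ^ 2 * bigLam (1 / 10) ^ (76 : ℕ)) * (bigLam (1 / 10) * ϑt ^ 2) ^ j := by
  have e : ((76 : ℤ) + (j : ℤ) - 76).toNat = j := by omega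
  unfold RT4; rw [if_neg (by omega), if_pos (by omega), e]

/-- The amplitude hulls near the bottom edge are `≤ Q β²`. [folklore] -/
theorem AT4_le_bot (k' : ℤ) (h1 : -1 - 1 ≤ k') (h2 : k' ≤ -1 + 1) : T4W76R.AT4 k' ≤ Q * T4W76R.βw ^ 2 := by
  interval_cases k' <;> norm_num [AT4, T4W76.Q, βw, gHi, toNat_two]

/-- The amplitude hulls near the top edge are `≤ ā_t`. [folklore] -/
theorem AT4_le_top (k' : ℤ) (h1 : (76 : ℤ) - 1 ≤ k') (h2 : k' ≤ (76 : ℤ) + 1) : T4W76R.AT4 k' ≤ abart := by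
  interval_cases k' <;> norm_num [AT4, T4W76.abart, T4W76.εR, ϑt]

variable (bd : BoxData)

/-- [folklore] -/
theorem frame_W : ((T4W76R.frame bd).W : ℤ) = 76 := by show ((76 : ℕ) : ℤ) = 76; norm_num
/-- [folklore] -/
theorem frame_W' : (T4W76R.frame bd).W = 76 := rfl
/-- [folklore] -/
theorem frame_τhi : (T4W76R.frame bd).τhi = τc + rτ := rfl
/-- [folklore] -/
theorem frame_rτ : (T4W76R.frame bd).rτ = rτ := rfl
/-- [folklore] -/
theorem frame_wt (k : ℤ) : (T4W76R.frame bd).wt k = T4W76R.wtT4 k := rfl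
/-- [folklore] -/
theorem frame_tubeR (k : ℤ) : (T4W76R.frame bd).tubeR k = T4W76R.tubeRT4 k := rfl
/-- [folklore] -/
theorem frame_tubeC (i : Fin 4) (k : ℤ) : (T4W76R.frame bd).tubeC i k = tubeCT4 (fun i => bd.yc i 0) i k := rfl
/-- [folklore] -/
theorem wtT4_m1 : T4W76R.wtT4 (-1) = T4W76R.θw := by norm_num [wtT4]
/-- [folklore] -/
theorem wtT4_76 : T4W76R.wtT4 76 = ωt := by norm_num [wtT4]

/-- The distance coefficients near the bottom edge are in `[0, θ²]`. [folklore] -/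
theorem D_le_bot (k' : ℤ) (h1 : -1 - 1 ≤ k') (h2 : k' ≤ -1 + 1) :
    (0 ≤ (if (T4W76R.frame bd).InWindow k' then
        vmaxT4 k' + χbT4 k' * (T4W76R.frame bd).wt (-1) + χeT4 k' * (T4W76R.frame bd).wt (T4W76R.frame bd).W else (T4W76R.frame bd).wt k')) ∧
    (if (T4W76R.frame bd).InWindow k' then
        vmaxT4 k' + χbT4 k' * (T4W76R.frame bd).wt (-1) + χeT4 k' * (T4W76R.frame bd).wt (T4W76R.frame bd).W else (T4W76R.frame bd).wt k')
      ≤ θw ^ 2 := by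
  interval_cases k' <;>
    norm_num [OneShiftFrame.InWindow, frame, wtT4, vmaxT4, χbT4, χeT4, θw, gHi, T4W76.ωt, toNat_two]

/-- The distance coefficients near the top edge are in `[0, 4·10⁻¹²]`. [folklore] -/
theorem D_le_top (k' : ℤ) (h1 : ((T4W76R.frame bd).W : ℤ) - 1 ≤ k') (h2 : k' ≤ ((T4W76R.frame bd).W : ℤ) + 1) :
    (0 ≤ (if (T4W76R.frame bd).InWindow k' then
        vmaxT4 k' + χbT4 k' * (T4W76R.frame bd).wt (-1) + χeT4 k' * (T4W76R.frame bd).wt (T4W76R.frame bd).W else (T4W76R.frame bd).wt k')) ∧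
    (if (T4W76R.frame bd).InWindow k' then
        vmaxT4 k' + χbT4 k' * (T4W76R.frame bd).wt (-1) + χeT4 k' * (T4W76R.frame bd).wt (T4W76R.frame bd).W else (T4W76R.frame bd).wt k')
      ≤ 4 / 10 ^ 12 := by
  rw [frame_W] at h1 h2
  interval_cases k' <;>
    norm_num [OneShiftFrame.InWindow, frame, wtT4, vmaxT4, χbT4, χeT4, θw, gHi, T4W76.ωt, ϑt, toNat_two]

/-- [folklore] -/
theorem AT4_le_top' (k' : ℤ) (h1 : ((T4W76R.frame bd).W : ℤ) - 1 ≤ k') (h2 : k' ≤ ((T4W76R.frame bd).W : ℤ) + 1) :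
    T4W76R.AT4 k' ≤ abart := by
  rw [frame_W] at h1 h2; exact AT4_le_top k' h1 h2

/-! ### The nine rows of `…_v7s` for the variant (`q = 13/25`) -/

/-- Row `hRBm1` (table-sparse rate at the wake edge). [cite: Tao2016AveragedNS, §4 (4.8); cell vocabulary, harvest/h2-tao-ladder rung1/INSTANCE-SHEET-T4-0.1-W76.md] -/
theorem row_RBm1 (i : Fin 4) : quadTermLip (1 / 10) αT4 T4W76R.AT4 T4W76R.AT4 i (-1) ≤ 2 * T4W76R.RT4 (-1) := by
  have hε : (0 : ℝ) < 1 + 1 / 10 := by norm_num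
  have hΛ1 : 1 ≤ bigLam (1 / 10 : ℝ) := one_le_bigLam (by norm_num)
  have hpos : 0 < bigLam (1 / 10 : ℝ) := bigLam_pos (by norm_num)
  have hS := tableAbsSum_αT4_le i
  have henv := quadTermLip_le_of_bounds hε hΛ1 αT4 (n := -1) (fun k' _ _ => AT4_nonneg k')
    (fun k' _ _ => AT4_nonneg k') AT4_le_bot AT4_le_bot i
  have hR := RT4_wake 0
  norm_num at hR
  rw [zpow_neg_one] at henv
  rw [hR]
  have hL0 : 0 ≤ (bigLam (1 / 10 : ℝ))⁻¹ := by positivity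
  have hTL : tableAbsSum αT4 i * (bigLam (1 / 10))⁻¹ ≤ S * (bigLam (1 / 10))⁻¹ :=
    mul_le_mul_of_nonneg_right hS hL0
  unfold T4W76.S T4W76.Q βw gHi at *
  nlinarith [hTL, henv, hL0]

/-- Row `hRBW` (table-sparse rate at the top edge). [cite: Tao2016AveragedNS, §4 (4.8); cell vocabulary, harvest/h2-tao-ladder rung1/INSTANCE-SHEET-T4-0.1-W76.md] -/
theorem row_RBW (i : Fin 4) :
    quadTermLip (1 / 10) αT4 T4W76R.AT4 T4W76R.AT4 i ((T4W76R.frame bd).W : ℤ) ≤ 2 * T4W76R.RT4 ((T4W76R.frame bd).W : ℤ) := by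
  have hε : (0 : ℝ) < 1 + 1 / 10 := by norm_num
  have hΛ1 : 1 ≤ bigLam (1 / 10 : ℝ) := one_le_bigLam (by norm_num)
  have hS := tableAbsSum_αT4_le i
  have henv := quadTermLip_le_of_bounds hε hΛ1 αT4 (n := ((T4W76R.frame bd).W : ℤ)) (fun k' _ _ => AT4_nonneg k')
    (fun k' _ _ => AT4_nonneg k') (AT4_le_top' bd) (AT4_le_top' bd) i
  have hR := RT4_top 0
  simp only [Nat.cast_zero, add_zero, pow_zero, mul_one] at hR
  rw [frame_W] at henv ⊢
  rw [zpow_ofNat, bigLam_tenth_pow_76] at henv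
  rw [hR, bigLam_tenth_pow_76]
  unfold T4W76.S T4W76.abart at *
  nlinarith [hS, henv]

/-- Row `hrowB` (contraction row at the wake edge `k = -1`, reading the window bottom; shell-0 numbers `(10⁻³, 10⁻³, 10²⁰)`,
`γ = (10⁻⁶, 10⁻⁶, 10²²)`). [cite: Tao2016AveragedNS, §4 (4.8), §5.3; cell vocabulary, harvest/h2-tao-ladder rung1/STAGE3-BANACH.md §2] -/
theorem row_B (i : Fin 4) :
    gHi * (1 / 10 ^ 3 + 1 / 10 ^ 3 * (T4W76R.frame bd).wt (-1) + 10 ^ 20 * (T4W76R.frame bd).wt (T4W76R.frame bd).W) +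
      AT4 0 * (1 / 10 ^ 6 + 1 / 10 ^ 6 * (T4W76R.frame bd).wt (-1) + 10 ^ 22 * (T4W76R.frame bd).wt (T4W76R.frame bd).W) +
      (T4W76R.frame bd).τhi * quadTermLip (1 / 10) αT4 AT4
        (fun k' => if (T4W76R.frame bd).InWindow k' then
          vmaxT4 k' + χbT4 k' * (T4W76R.frame bd).wt (-1) + χeT4 k' * (T4W76R.frame bd).wt (T4W76R.frame bd).W else (T4W76R.frame bd).wt k')
        i (-1) ≤ 13 / 25 * (T4W76R.frame bd).wt (-1) := by
  have hε : (0 : ℝ) < 1 + 1 / 10 := by norm_num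
  have hΛ1 : 1 ≤ bigLam (1 / 10 : ℝ) := one_le_bigLam (by norm_num)
  have hpos : 0 < bigLam (1 / 10 : ℝ) := bigLam_pos (by norm_num)
  have hS := tableAbsSum_αT4_le i
  have hS0 := tableAbsSum_nonneg i
  have henv := quadTermLip_le_of_bounds hε hΛ1 αT4 (n := -1) (fun k' _ _ => AT4_nonneg k')
    (fun k' h1 h2 => (D_le_bot bd k' h1 h2).1) AT4_le_bot (fun k' h1 h2 => (D_le_bot bd k' h1 h2).2) i
  rw [zpow_neg_one] at henv
  have hL1 : (bigLam (1 / 10 : ℝ))⁻¹ ≤ 1 := inv_le_one_of_one_le₀ hΛ1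
  have hL0 : 0 ≤ (bigLam (1 / 10 : ℝ))⁻¹ := by positivity
  have hTL : tableAbsSum αT4 i * (bigLam (1 / 10))⁻¹ ≤ S * 1 := mul_le_mul hS hL1 hL0 (hS0.trans hS)
  have key := mul_le_mul_of_nonneg_left henv (τhi_nonneg)
  have hA0 : AT4 0 = Q := by norm_num [AT4]
  rw [frame_τhi]
  simp only [frame_wt, frame_W, wtT4_m1, wtT4_76, hA0] at key ⊢
  unfold T4W76.S T4W76.Q βw θw gHi T4W76.ωt T4W76.τc T4W76.rτ at *
  nlinarith [key, hTL]

/-- Row `hrowT` (contraction row at the top edge `k = W`, reading the window top; shell-75 numbers `(10⁻¹², 10⁻¹², 10¹⁸)`).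
[cite: Tao2016AveragedNS, §4 (4.8), §5.3; cell vocabulary, harvest/h2-tao-ladder rung1/STAGE3-BANACH.md §2] -/
theorem row_T (i : Fin 4) :
    gHi * ((T4W76R.frame bd).wt (((T4W76R.frame bd).W : ℤ) + 1) + RT4 (((T4W76R.frame bd).W : ℤ) + 1) * (T4W76R.frame bd).rτ) +
      AT4 (((T4W76R.frame bd).W : ℤ) + 1) *
        (1 / 10 ^ 6 + 1 / 10 ^ 6 * (T4W76R.frame bd).wt (-1) + 10 ^ 22 * (T4W76R.frame bd).wt (T4W76R.frame bd).W) +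
      (T4W76R.frame bd).τhi * quadTermLip (1 / 10) αT4 AT4
        (fun k' => if (T4W76R.frame bd).InWindow k' then
          vmaxT4 k' + χbT4 k' * (T4W76R.frame bd).wt (-1) + χeT4 k' * (T4W76R.frame bd).wt (T4W76R.frame bd).W else (T4W76R.frame bd).wt k')
        i (T4W76R.frame bd).W ≤ 13 / 25 * (T4W76R.frame bd).wt (T4W76R.frame bd).W := by
  have hε : (0 : ℝ) < 1 + 1 / 10 := by norm_num
  have hΛ1 : 1 ≤ bigLam (1 / 10 : ℝ) := one_le_bigLam (by norm_num)
  have hpos : 0 < bigLam (1 / 10 : ℝ) := bigLam_pos (by norm_num)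
  obtain ⟨-, hΛhi⟩ := bigLam_tenth_bounds
  have hS := tableAbsSum_αT4_le i
  have hS0 := tableAbsSum_nonneg i
  have henv := quadTermLip_le_of_bounds hε hΛ1 αT4 (n := ((T4W76R.frame bd).W : ℤ)) (fun k' _ _ => AT4_nonneg k')
    (fun k' h1 h2 => (D_le_top bd k' h1 h2).1) (AT4_le_top' bd) (fun k' h1 h2 => (D_le_top bd k' h1 h2).2) i
  have key := mul_le_mul_of_nonneg_left henv (τhi_nonneg)
  have hw77 : wtT4 (76 + 1) = ωt * ϑt ^ 1 := by exact_mod_cast wtT4_top 1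
  have hA77 : AT4 (76 + 1) = εR * ϑt ^ 1 := by exact_mod_cast AT4_top 1
  have hR77 : RT4 (76 + 1) = (S * abart ^ 2 * bigLam (1 / 10) ^ (76 : ℕ)) * (bigLam (1 / 10) * ϑt ^ 2) ^ 1 := by
    exact_mod_cast RT4_top 1
  rw [frame_τhi, frame_rτ]
  simp only [frame_wt, frame_W, wtT4_m1, wtT4_76, hw77, hA77, hR77, pow_one, zpow_ofNat,
    bigLam_tenth_pow_76] at key ⊢
  have hTΛ : tableAbsSum αT4 i ≤ S := hS
  have hRb : S * abart ^ 2 * ((161051 : ℝ) / 100000) ^ 38 * (bigLam (1 / 10) * ϑt ^ 2) ≤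
      S * abart ^ 2 * ((161051 : ℝ) / 100000) ^ 38 * (12691 / 10000 * ϑt ^ 2) := by
    unfold T4W76.S T4W76.abart ϑt; gcongr
  unfold T4W76.S T4W76.abart θw gHi T4W76.ωt T4W76.εR ϑt T4W76.τc T4W76.rτ at *
  nlinarith [key, hTΛ, hRb]

/-- Row `hfirstW` (first interior wake contraction row `k = -2`). [cite: Tao2016AveragedNS, §4 (4.8); cell vocabulary, harvest/h2-tao-ladder rung1/STAGE3-BANACH.md §2 (θ_w)] -/
theorem row_firstW (i : Fin 4) :
    gHi * (1 * θw + (S * Q ^ 2 * βw ^ 2) * (βw ^ 2 * (bigLam (1 / 10))⁻¹) * (T4W76R.frame bd).rτ) +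
      Q * βw * (1 / 10 ^ 6 + 1 / 10 ^ 6 * (T4W76R.frame bd).wt (-1) + 10 ^ 22 * (T4W76R.frame bd).wt (T4W76R.frame bd).W) +
      (T4W76R.frame bd).τhi * (2 * tableAbsSum αT4 i * (bigLam (1 / 10))⁻¹ ^ 2 * (1 * θw ^ 3) * (Q * βw ^ 3)) ≤
      13 / 25 * (1 * θw ^ 2) := by
  have hΛ1 : 1 ≤ bigLam (1 / 10 : ℝ) := one_le_bigLam (by norm_num)
  have hpos : 0 < bigLam (1 / 10 : ℝ) := bigLam_pos (by norm_num)
  have hS := tableAbsSum_αT4_le i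
  have hS0 := tableAbsSum_nonneg i
  have hL1 : (bigLam (1 / 10 : ℝ))⁻¹ ≤ 1 := inv_le_one_of_one_le₀ hΛ1
  have hL0 : 0 ≤ (bigLam (1 / 10 : ℝ))⁻¹ := by positivity
  have hTL2 : tableAbsSum αT4 i * (bigLam (1 / 10))⁻¹ ^ 2 ≤ S * 1 :=
    mul_le_mul hS (by nlinarith) (by positivity) (hS0.trans hS)
  rw [frame_τhi, frame_rτ]
  simp only [frame_wt, frame_W, wtT4_m1, wtT4_76]
  unfold T4W76.S T4W76.Q βw θw gHi T4W76.ωt T4W76.τc T4W76.rτ at *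
  nlinarith [hTL2, hL1, hL0]

/-- Row `hfirstWS` (wake self-map row, hull deviation `max (gHi − ĝ) (ĝ − gLo) = 1.32756·10⁻⁵`). [cite: Tao2016AveragedNS, §4 (4.8); cell vocabulary, harvest/h2-tao-ladder rung1/STAGE2-LEMMA.md §5 (Lemma 4a)] -/
theorem row_firstWS :
    cmax * max (T4W76R.gHi - ghat) (ghat - T4W76R.gLo) * ghat +
      (T4W76R.frame bd).τhi * ((S * Q ^ 2 * βw ^ 2) * (βw ^ 2 * (bigLam (1 / 10))⁻¹) ^ 2) ≤ κw * gHi ^ 2 := by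
  have hΛ1 : 1 ≤ bigLam (1 / 10 : ℝ) := one_le_bigLam (by norm_num)
  have hpos : 0 < bigLam (1 / 10 : ℝ) := bigLam_pos (by norm_num)
  have hL1 : (bigLam (1 / 10 : ℝ))⁻¹ ≤ 1 := inv_le_one_of_one_le₀ hΛ1
  have hL0 : 0 ≤ (bigLam (1 / 10 : ℝ))⁻¹ := by positivity
  have hL2 : (bigLam (1 / 10 : ℝ))⁻¹ ^ 2 ≤ 1 := pow_le_one₀ hL0 hL1
  have hmax : max (gHi - ghat) (ghat - gLo) = 132756 / 10 ^ 10 := by norm_num [gHi, T4W76.ghat, gLo]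
  rw [hmax, frame_τhi]
  unfold T4W76.cmax T4W76.ghat T4W76.S T4W76.Q βw gHi T4W76.κw T4W76.τc T4W76.rτ
  nlinarith [hL2]

/-- Row `hfirstT` (first interior top contraction row `k = W+1`, top ratio `1/16`). [cite: Tao2016AveragedNS, §4 (4.8); cell vocabulary, harvest/h2-tao-ladder rung1/STAGE3-BANACH.md §2 (θ_t)] -/
theorem row_firstT (i : Fin 4) :
    gHi * (ωt * ϑt ^ 2 +
        (S * abart ^ 2 * bigLam (1 / 10) ^ (T4W76R.frame bd).W) * (bigLam (1 / 10) * ϑt ^ 2) ^ 2 * (T4W76R.frame bd).rτ) +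
      (abart * ϑt) * ϑt ^ 2 *
        (1 / 10 ^ 6 + 1 / 10 ^ 6 * (T4W76R.frame bd).wt (-1) + 10 ^ 22 * (T4W76R.frame bd).wt (T4W76R.frame bd).W) +
      (T4W76R.frame bd).τhi * (2 * tableAbsSum αT4 i * bigLam (1 / 10) ^ ((T4W76R.frame bd).W + 1) * ωt * (abart * ϑt)) ≤
      13 / 25 * (ωt * ϑt) := by
  have hpos : 0 < bigLam (1 / 10 : ℝ) := bigLam_pos (by norm_num)
  obtain ⟨-, hΛhi⟩ := bigLam_tenth_bounds
  have h2 : bigLam (1 / 10 : ℝ) ^ 2 = 161051 / 100000 := by rw [bigLam_sq (by norm_num)]; norm_num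
  have hS := tableAbsSum_αT4_le i
  have hS0 := tableAbsSum_nonneg i
  have hTΛ : tableAbsSum αT4 i * bigLam (1 / 10) ≤ S * (12691 / 10000) := mul_le_mul hS hΛhi hpos.le (hS0.trans hS)
  have h77 : bigLam (1 / 10 : ℝ) ^ ((T4W76R.frame bd).W + 1) = (161051 / 100000) ^ 38 * bigLam (1 / 10) := by
    rw [frame_W', pow_succ, bigLam_tenth_pow_76]
  have h76 : bigLam (1 / 10 : ℝ) ^ (T4W76R.frame bd).W = (161051 / 100000) ^ 38 := by
    rw [frame_W', bigLam_tenth_pow_76]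
  rw [h77, h76, frame_τhi, frame_rτ]
  simp only [frame_wt, frame_W, wtT4_m1, wtT4_76]
  unfold T4W76.S T4W76.abart θw gHi T4W76.ωt ϑt T4W76.τc T4W76.rτ at *
  nlinarith [hTΛ, h2]

/-- Row `hfirstTS` (top self-map row). [cite: Tao2016AveragedNS, §4 (4.8); cell vocabulary, harvest/h2-tao-ladder rung1/STAGE2-LEMMA.md §5 (Lemma 4b)] -/
theorem row_firstTS :
    gHi * (εR * ϑt) + (T4W76R.frame bd).τhi * (S * abart ^ 2 * bigLam (1 / 10) ^ (T4W76R.frame bd).W) ≤ εR := by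
  rw [frame_τhi, frame_W', bigLam_tenth_pow_76]
  unfold gHi T4W76.εR ϑt T4W76.S T4W76.abart T4W76.τc T4W76.rτ
  norm_num

/-- Row `hrow1` (wake entry row, `A₁ = 10⁻⁵`). [cite: Tao2016AveragedNS, §5.3; cell vocabulary, harvest/h2-tao-ladder rung1/STAGE2-LEMMA.md §5] -/
theorem row_1 : 1 / 10 ^ 5 + (T4W76R.frame bd).τhi * RT4 (-1) ≤ (T4W76R.frame bd).tubeR (-1) := by
  have hΛ1 : 1 ≤ bigLam (1 / 10 : ℝ) := one_le_bigLam (by norm_num)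
  have hpos : 0 < bigLam (1 / 10 : ℝ) := bigLam_pos (by norm_num)
  have hL1 : (bigLam (1 / 10 : ℝ))⁻¹ ≤ 1 := inv_le_one_of_one_le₀ hΛ1
  have hR := RT4_wake 0
  norm_num at hR
  have ht : tubeRT4 (-1) = gHi * (r₀ + κw) := by norm_num [tubeRT4]
  rw [frame_τhi, frame_tubeR, hR, ht]
  unfold T4W76.S T4W76.Q βw gHi r₀ T4W76.κw T4W76.τc T4W76.rτ
  nlinarith [hL1]

/-- Window row `hqX` (`Z = 1/50`, `S_b = 1/20`, `S_e = 10²⁸`). [cite: Tao2016AveragedNS, §5.3; cell vocabulary, harvest/h2-tao-ladder rung1/STAGE3-BANACH.md §2 (row 1 of L̃)] -/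
theorem row_qX :
    1 / 50 + 1 / 20 * (T4W76R.frame bd).wt (-1) + 10 ^ 28 * (T4W76R.frame bd).wt (T4W76R.frame bd).W ≤ 13 / 25 := by
  simp only [frame_wt, frame_W, wtT4_m1, wtT4_76]
  unfold θw gHi T4W76.ωt; norm_num

end T4W76R

end DSSOneShift

end Summit.NavierStokesRegularity.NavierStokesRegularity.Theorems
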